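import Summits.AtomisticToContinuum.BoseEinsteinCondensation.Theorems.BECConjugateDominationHardCoreExtensionSmoothedGeneratorPointwise
import Mathlib.MeasureTheory.Integral.Prod
import HarnessLib

/-!
# The Feynman–Kac generator under one free smoothing, for BOUNDED MEASURABLE interactions, II:
# the smoothed translate and the Fubini exchange (stub `stub_smoothedGenerator` = S6r-B1 of line
# `third-law-current-floor`, crux `HardCoreExtension`, stmt-AtomisticToContinuum-11786)

The third piece `F₃(Y) = (E[A_h(Y,·)] − hW(Y))Ψ₀(Y)` of part I read under the free smoothing `P_s`
(`s > 0`): with `G(U) = E[Ψ₀(X + √2b_s) W(X + √2b_s + U)] = ∫ gaussKer s (Z − U) Ψ₀(X + Z − U) W(X + Z) dZ`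
(continuous at `U = 0` by dominated convergence, the shifted kernel dominated through `gaussKer_sub_le`),
one Fubini exchange gives `P_s F₃ (X) = ∫_{W × (0,h]} (G(√2b_{r}(ω)) − G(0)) d(ω, r)`, whence
`|P_s F₃(X)| ≤ h(η' + (2‖G‖_∞/δ')·E[√2∑ runSup_h])` from the modulus of continuity of `G` at `0` and the
running suprema of the Brownian coordinates. Theorems only, no definition. [folklore]
-/

noncomputable section

namespace Summit.AtomisticToContinuum.BoseEinsteinCondensation.Cruxes.HardCoreExtension.ThirdLawCurrentFloor

open MeasureTheory ProbabilityTheory Filter Set Metric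
open scoped ENNReal NNReal Topology
open Literature.MathematicalPhysics.QuantumManyBody.BoseGas
open Literature.Probability.Process (brownian runSup runSup_nonneg)
open Summit.AtomisticToContinuum.BoseEinsteinCondensation.Theorems.PositiveMinimiser

namespace SmoothedGenerator

variable {N : ℕ} {v : ℝ → ℝ≥0∞} {L : ℝ} {C : ℝ≥0}

/-! ### The smoothed translate `G(U) = E[Ψ₀(X + √2b_s) W(X + √2b_s + U)]` and its continuity at `0` -/

section Translate

variable {Ψ₀ : Config N → ℝ} {M : ℝ}

/-- The integrand of `G(U)` is measurable in the sample. [folklore] -/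
theorem measurable_translate_integrand (hv : Measurable v) (hΨm : Measurable Ψ₀) (s : ℝ≥0) (X U : Config N) :
    Measurable fun ω : PathSpace N => Ψ₀ (X + displacement s ω) * (periodicInteraction v L (X + displacement s ω + U)).toReal :=
  (hΨm.comp (measurable_const.add (measurable_displacement s))).mul
    ((measurable_Wr hv L).comp ((measurable_const.add (measurable_displacement s)).add_const U))

/-- The integrand of `G(U)` is bounded by `M N²C`. [folklore] -/
theorem abs_translate_integrand_le (hC : ∀ x, periodizedPotential v L x ≤ C) (hM : ∀ Y, |Ψ₀ Y| ≤ M)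
    (s : ℝ≥0) (X U : Config N) (ω : PathSpace N) :
    |Ψ₀ (X + displacement s ω) * (periodicInteraction v L (X + displacement s ω + U)).toReal| ≤ M * (((N * N : ℕ) : ℝ) * C) := by
  rw [abs_mul]
  exact mul_le_mul (hM _) (abs_Wr_le hC _) (abs_nonneg _) ((abs_nonneg _).trans (hM 0))

/-- The integrand of `G(U)` is integrable. [folklore] -/
theorem integrable_translate_integrand (hv : Measurable v) (hC : ∀ x, periodizedPotential v L x ≤ C)
    (hΨm : Measurable Ψ₀) (hM : ∀ Y, |Ψ₀ Y| ≤ M) (s : ℝ≥0) (X U : Config N) :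
    Integrable (fun ω : PathSpace N => Ψ₀ (X + displacement s ω) * (periodicInteraction v L (X + displacement s ω + U)).toReal)
      (wienerPaths N) :=
  Integrable.of_bound (measurable_translate_integrand hv hΨm s X U).aestronglyMeasurable _
    (Eventually.of_forall fun ω => by rw [Real.norm_eq_abs]; exact abs_translate_integrand_le hC hM s X U ω)

/-- `|G(U)| ≤ M N²C`. [folklore] -/
theorem abs_smoothedTranslate_le (hC : ∀ x, periodizedPotential v L x ≤ C) (hM : ∀ Y, |Ψ₀ Y| ≤ M)
    (s : ℝ≥0) (X U : Config N) : |(∫ ω, Ψ₀ (X + displacement s ω) * (periodicInteraction v L (X + displacement s ω + U)).toReal ∂wienerPaths N)| ≤ M * (((N * N : ℕ) : ℝ) * C) := by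
  have hM0 : 0 ≤ M := (abs_nonneg _).trans (hM 0)
  rw [← Real.norm_eq_abs]
  refine (norm_integral_le_integral_norm _).trans ?_
  refine (integral_mono_of_nonneg (Eventually.of_forall fun _ => norm_nonneg _)
    (integrable_const (M * (((N * N : ℕ) : ℝ) * C))) (Eventually.of_forall fun ω => ?_)).trans (le_of_eq ?_)
  · simp only [Real.norm_eq_abs]; exact abs_translate_integrand_le hC hM s X U ω
  · simp

/-- **Kernel form of `G`**: for `s > 0`,
`G(U) = ∫ gaussKer s (Z − U) · Ψ₀(X + (Z − U)) · W(X + Z) dZ` (Gaussian density of the displacement,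
then the translation `Z ↦ Z − U` of Lebesgue measure). [folklore] -/
theorem smoothedTranslate_eq_integral_gaussKer (hv : Measurable v) (hΨm : Measurable Ψ₀) {s : ℝ≥0}
    (hs : s ≠ 0) (X U : Config N) :
    (∫ ω, Ψ₀ (X + displacement s ω) * (periodicInteraction v L (X + displacement s ω + U)).toReal ∂wienerPaths N) =
      ∫ Z, gaussKer s (Z - U) * (Ψ₀ (X + (Z - U)) * (periodicInteraction v L (X + Z)).toReal) := by
  have hF : AEStronglyMeasurable (fun Z : Config N => Ψ₀ (X + Z) * (periodicInteraction v L (X + Z + U)).toReal) volume :=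
    ((hΨm.comp (measurable_const.add measurable_id)).mul
      ((measurable_Wr hv L).comp ((measurable_const.add measurable_id).add_const U))).aestronglyMeasurable
  rw [integral_displacement_eq_integral_gaussKer_smul hs hF,
    ← integral_sub_right_eq_self (fun Z : Config N => gaussKer s Z • (Ψ₀ (X + Z) * (periodicInteraction v L (X + Z + U)).toReal)) U]
  refine integral_congr_ae (Eventually.of_forall fun Z => ?_)
  simp only [smul_eq_mul]
  rw [show X + (Z - U) + U = X + Z by rw [add_assoc, sub_add_cancel]]

/-- **`G` is continuous at `0`** (`s > 0`, continuous bounded `Ψ₀`, bounded measurable `W`): dominated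
convergence in the kernel form, the shifted kernel being dominated through `gaussKer_sub_le`.
[folklore] -/
theorem continuousAt_smoothedTranslate (hv : Measurable v) (hC : ∀ x, periodizedPotential v L x ≤ C)
    (hcont : Continuous Ψ₀) (hM : ∀ Y, |Ψ₀ Y| ≤ M) {s : ℝ≥0} (hs : s ≠ 0) (X : Config N) :
    ContinuousAt ((fun U : Config N => ∫ ω, Ψ₀ (X + displacement s ω) * (periodicInteraction v L (X + displacement s ω + U)).toReal ∂wienerPaths N)) 0 := by
  have hM0 : 0 ≤ M := (abs_nonneg _).trans (hM 0)
  have h2s : (2 : ℝ≥0) * s ≠ 0 := mul_ne_zero two_ne_zero hs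
  set K : ℝ := ∏ _i : Fin N, ∏ _k : Fin 3, (Real.sqrt 2 * Real.exp (1 ^ 2 / (4 * s))) with hK
  have hfun : (fun U : Config N => ∫ ω, Ψ₀ (X + displacement s ω) * (periodicInteraction v L (X + displacement s ω + U)).toReal ∂wienerPaths N) =
      fun U => ∫ Z, gaussKer s (Z - U) * (Ψ₀ (X + (Z - U)) * (periodicInteraction v L (X + Z)).toReal) :=
    funext fun U => smoothedTranslate_eq_integral_gaussKer hv hcont.measurable hs X U
  rw [hfun]
  refine continuousAt_of_dominated (bound := fun Z => K * gaussKer (2 * s) Z * (M * (((N * N : ℕ) : ℝ) * C)))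
    (Eventually.of_forall fun U => ?_) ?_ ?_ (Eventually.of_forall fun Z => ?_)
  · exact (((measurable_gaussKer s).comp (measurable_id.sub_const U)).mul
      ((hcont.measurable.comp (measurable_const.add (measurable_id.sub_const U))).mul
        ((measurable_Wr hv L).comp (measurable_const.add measurable_id)))).aestronglyMeasurable
  · filter_upwards [Metric.ball_mem_nhds (0 : Config N) one_pos] with U hU
    refine Eventually.of_forall fun Z => ?_
    rw [Metric.mem_ball, dist_zero_right] at hU
    rw [Real.norm_eq_abs, abs_mul, abs_of_nonneg (gaussKer_nonneg _ _), abs_mul]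
    refine mul_le_mul (gaussKer_sub_le s Z U hU.le) (mul_le_mul (hM _) (abs_Wr_le hC _) (abs_nonneg _) hM0)
      (mul_nonneg (abs_nonneg _) (abs_nonneg _)) ?_
    exact mul_nonneg (Finset.prod_nonneg fun _ _ => Finset.prod_nonneg fun _ _ => by positivity)
      (gaussKer_nonneg _ _)
  · exact ((integrable_gaussKer h2s).const_mul K).mul_const _
  · exact ((((continuous_gaussKer s).comp (continuous_const.sub continuous_id)).mul
      ((hcont.comp (continuous_const.add (continuous_const.sub continuous_id))).mul
        continuous_const))).continuousAt

/-- **Modulus of continuity of `G` at `0`**: for `η' > 0` there is `δ' > 0` with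
`|G(U) − G(0)| ≤ η'` whenever `‖U‖ < δ'`. [folklore] -/
theorem exists_delta_smoothedTranslate (hv : Measurable v) (hC : ∀ x, periodizedPotential v L x ≤ C)
    (hcont : Continuous Ψ₀) (hM : ∀ Y, |Ψ₀ Y| ≤ M) {s : ℝ≥0} (hs : s ≠ 0) (X : Config N) {η' : ℝ}
    (hη' : 0 < η') :
    ∃ δ' > 0, ∀ U : Config N, ‖U‖ < δ' →
      |(∫ ω, Ψ₀ (X + displacement s ω) * (periodicInteraction v L (X + displacement s ω + U)).toReal ∂wienerPaths N) - (fun U : Config N => ∫ ω, Ψ₀ (X + displacement s ω) * (periodicInteraction v L (X + displacement s ω + U)).toReal ∂wienerPaths N) 0| ≤ η' := by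
  obtain ⟨δ', hδ', h⟩ := Metric.continuousAt_iff.1 (continuousAt_smoothedTranslate hv hC hcont hM hs X) η' hη'
  refine ⟨δ', hδ', fun U hU => ?_⟩
  have := h (by rwa [dist_zero_right])
  rw [Real.dist_eq] at this
  exact this.le

end Translate

/-! ### The third piece through Fubini: `P_s F₃ (X) = ∫∫ (G(√2 b_{r}) − G(0)) dr dW` -/

section Fubini

variable {Ψ₀ : Config N → ℝ} {M : ℝ}

/-- `|W(a) − W(b)| ≤ N²C`. [folklore] -/
theorem abs_Wr_sub_Wr_le (hC : ∀ x, periodizedPotential v L x ≤ C) (a b : Config N) :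
    |(periodicInteraction v L a).toReal - (periodicInteraction v L b).toReal| ≤ ((N * N : ℕ) : ℝ) * C := by
  rw [abs_sub_le_iff]
  constructor <;> linarith [Wr_nonneg v L a, Wr_nonneg v L b, toReal_periodicInteraction_le hC a, toReal_periodicInteraction_le hC b]

/-- The clipped displacement `(ω, r) ↦ √2 b_{min(r⁺,t)}(ω)` is jointly measurable. [folklore] -/
theorem measurable_clippedDisplacement (t : ℝ≥0) :
    Measurable fun q : PathSpace N × ℝ => displacement (min q.2.toNNReal t) q.1 :=
  measurable_displacement_uncurry.comp
    (((measurable_real_toNNReal.comp measurable_snd).min measurable_const).prodMk measurable_fst)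

/-- **The third piece as a product integral**: for `0 ≤ h`,
`F₃(Y) = ∫_{(ω,r) ∈ W × (0,h]} Ψ₀(Y)(W(Y + √2 b_{min(r⁺,h⁺)}(ω)) − W(Y))`. [folklore] -/
theorem thirdPiece_eq_integral_prod (hv : Measurable v) (hC : ∀ x, periodizedPotential v L x ≤ C)
    {h : ℝ} (hh : 0 ≤ h) (Ψ₀ : Config N → ℝ) (Y : Config N) :
    (((∫ ω, (periodicPathAction v L h Y ω).toReal ∂wienerPaths N) - h * (periodicInteraction v L Y).toReal) * Ψ₀ Y) =
      ∫ q, Ψ₀ Y * ((periodicInteraction v L (Y + displacement (min q.2.toNNReal h.toNNReal) q.1)).toReal - (periodicInteraction v L Y).toReal)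
        ∂(wienerPaths N).prod (volume.restrict (Ioc (0 : ℝ) h)) := by
  haveI : Fact (volume (Ioc (0 : ℝ) h) < ∞) := ⟨measure_Ioc_lt_top⟩
  have hmeas : Measurable fun q : PathSpace N × ℝ =>
      (periodicInteraction v L (Y + displacement (min q.2.toNNReal h.toNNReal) q.1)).toReal - (periodicInteraction v L Y).toReal :=
    ((measurable_Wr hv L).comp (measurable_const.add (measurable_clippedDisplacement _))).sub_const _
  have hint : Integrable (fun q : PathSpace N × ℝ =>
      (periodicInteraction v L (Y + displacement (min q.2.toNNReal h.toNNReal) q.1)).toReal - (periodicInteraction v L Y).toReal)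
      ((wienerPaths N).prod (volume.restrict (Ioc (0 : ℝ) h))) :=
    Integrable.of_bound hmeas.aestronglyMeasurable _
      (Eventually.of_forall fun q => by rw [Real.norm_eq_abs]; exact abs_Wr_sub_Wr_le hC _ _)
  rw [integral_const_mul, integral_prod _ hint, mul_comm]
  congr 1
  have hfun : (fun x : PathSpace N => ∫ y in Ioc (0 : ℝ) h,
      ((periodicInteraction v L (Y + displacement (min (x, y).2.toNNReal h.toNNReal) (x, y).1)).toReal - (periodicInteraction v L Y).toReal)) =
      fun ω => (periodicPathAction v L h Y ω).toReal - h * (periodicInteraction v L Y).toReal := by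
    funext ω
    exact (toReal_periodicPathAction_sub_eq_integral hv hC hh Y ω).symm
  rw [hfun, integral_sub (integrable_toReal_periodicPathAction hv hC hh Y) (integrable_const _), integral_const]
  simp

/-- The exchanged integrand is jointly measurable. [folklore] -/
theorem measurable_uncurry_exchInt (hv : Measurable v) (hΨm : Measurable Ψ₀) (s : ℝ≥0) (h : ℝ)
    (X : Config N) :
    Measurable ((Function.uncurry fun (ω' : PathSpace N) (q : PathSpace N × ℝ) => (Ψ₀ (X + displacement s ω') * ((periodicInteraction v L (X + displacement s ω' + displacement (min (q).2.toNNReal (h).toNNReal) (q).1)).toReal - (periodicInteraction v L (X + displacement s ω')).toReal)))) := by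
  have h1 : Measurable fun p : PathSpace N × (PathSpace N × ℝ) => X + displacement s p.1 :=
    measurable_const.add ((measurable_displacement s).comp measurable_fst)
  have h2 : Measurable fun p : PathSpace N × (PathSpace N × ℝ) =>
      displacement (min p.2.2.toNNReal h.toNNReal) p.2.1 :=
    (measurable_clippedDisplacement _).comp measurable_snd
  exact (hΨm.comp h1).mul (((measurable_Wr hv L).comp (h1.add h2)).sub ((measurable_Wr hv L).comp h1))

/-- The exchanged integrand is bounded by `M N²C`. [folklore] -/
theorem abs_exchInt_le (hC : ∀ x, periodizedPotential v L x ≤ C) (hM : ∀ Y, |Ψ₀ Y| ≤ M) (s : ℝ≥0)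
    (h : ℝ) (X : Config N) (ω' : PathSpace N) (q : PathSpace N × ℝ) :
    |(Ψ₀ (X + displacement s ω') * ((periodicInteraction v L (X + displacement s ω' + displacement (min (q).2.toNNReal (h).toNNReal) (q).1)).toReal - (periodicInteraction v L (X + displacement s ω')).toReal))| ≤ M * (((N * N : ℕ) : ℝ) * C) := by
  rw [abs_mul]
  exact mul_le_mul (hM _) (abs_Wr_sub_Wr_le hC _ _) (abs_nonneg _) ((abs_nonneg _).trans (hM 0))

/-- **`P_s F₃(X)` with the order of integration exchanged**: for `0 ≤ h`,
`P_s F₃ (X) = ∫_{(ω,r)} ∫_{ω'} Φ(ω', (ω, r)) dW' d(W × (0,h])`. [folklore] -/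
theorem heatOp_thirdPiece_eq (hv : Measurable v) (hC : ∀ x, periodizedPotential v L x ≤ C)
    (hΨm : Measurable Ψ₀) (hM : ∀ Y, |Ψ₀ Y| ≤ M) (s : ℝ≥0) {h : ℝ} (hh : 0 ≤ h) (X : Config N) :
    heatOp s ((fun Y : Config N => ((∫ ω, (periodicPathAction v L h Y ω).toReal ∂wienerPaths N) - h * (periodicInteraction v L Y).toReal) * Ψ₀ Y)) X =
      ∫ q, ∫ ω', (Ψ₀ (X + displacement s ω') * ((periodicInteraction v L (X + displacement s ω' + displacement (min (q).2.toNNReal (h).toNNReal) (q).1)).toReal - (periodicInteraction v L (X + displacement s ω')).toReal)) ∂wienerPaths N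
        ∂(wienerPaths N).prod (volume.restrict (Ioc (0 : ℝ) h)) := by
  haveI : Fact (volume (Ioc (0 : ℝ) h) < ∞) := ⟨measure_Ioc_lt_top⟩
  have hint : Integrable ((Function.uncurry fun (ω' : PathSpace N) (q : PathSpace N × ℝ) => (Ψ₀ (X + displacement s ω') * ((periodicInteraction v L (X + displacement s ω' + displacement (min (q).2.toNNReal (h).toNNReal) (q).1)).toReal - (periodicInteraction v L (X + displacement s ω')).toReal))))
      ((wienerPaths N).prod ((wienerPaths N).prod (volume.restrict (Ioc (0 : ℝ) h)))) :=
    Integrable.of_bound (measurable_uncurry_exchInt hv hΨm s h X).aestronglyMeasurable _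
      (Eventually.of_forall fun p => by
        simp only [Function.uncurry, Real.norm_eq_abs]; exact abs_exchInt_le hC hM s h X p.1 p.2)
  rw [← integral_integral_swap hint, heatOp]
  refine integral_congr_ae (Eventually.of_forall fun ω' => ?_)
  exact thirdPiece_eq_integral_prod hv hC hh Ψ₀ _

/-- **The inner integral is a difference of smoothed translates**:
`∫ Φ(ω', (ω, r)) dW'(ω') = G(√2 b_{min(r⁺,h⁺)}(ω)) − G(0)`. [folklore] -/
theorem integral_exchInt_eq (hv : Measurable v) (hC : ∀ x, periodizedPotential v L x ≤ C)
    (hΨm : Measurable Ψ₀) (hM : ∀ Y, |Ψ₀ Y| ≤ M) (s : ℝ≥0) (h : ℝ) (X : Config N) (q : PathSpace N × ℝ) :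
    ∫ ω', (Ψ₀ (X + displacement s ω') * ((periodicInteraction v L (X + displacement s ω' + displacement (min (q).2.toNNReal (h).toNNReal) (q).1)).toReal - (periodicInteraction v L (X + displacement s ω')).toReal)) ∂wienerPaths N =
      (∫ ω, Ψ₀ (X + displacement s ω) * (periodicInteraction v L (X + displacement s ω + (displacement (min q.2.toNNReal h.toNNReal) q.1))).toReal ∂wienerPaths N) -
        (fun U : Config N => ∫ ω, Ψ₀ (X + displacement s ω) * (periodicInteraction v L (X + displacement s ω + U)).toReal ∂wienerPaths N) 0 := by
  rw [← integral_sub (integrable_translate_integrand hv hC hΨm hM s X _)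
    (integrable_translate_integrand hv hC hΨm hM s X 0)]
  refine integral_congr_ae (Eventually.of_forall fun ω' => ?_)
  simp only [add_zero]
  ring

/-- **Pointwise bound of the inner integral** through the modulus of continuity of `G` at `0` and the
running suprema: if `‖U‖ < δ' ⇒ |G(U) − G(0)| ≤ η'` and `|G| ≤ G_b`, then for `0 ≤ h` and every `(ω, r)`,
`|∫ Φ dW'| ≤ η' + (2G_b/δ') · √2 ∑ᵢₖ runSup h⁺ (ω i k)`. [folklore] -/
theorem abs_integral_exchInt_le (hv : Measurable v) (hC : ∀ x, periodizedPotential v L x ≤ C)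
    (hΨm : Measurable Ψ₀) (hM : ∀ Y, |Ψ₀ Y| ≤ M) (s : ℝ≥0) (h : ℝ) (X : Config N) {η' δ' : ℝ}
    (hη' : 0 ≤ η') (hδ' : 0 < δ')
    (hmod : ∀ U : Config N, ‖U‖ < δ' →
      |(∫ ω, Ψ₀ (X + displacement s ω) * (periodicInteraction v L (X + displacement s ω + U)).toReal ∂wienerPaths N) - (fun U : Config N => ∫ ω, Ψ₀ (X + displacement s ω) * (periodicInteraction v L (X + displacement s ω + U)).toReal ∂wienerPaths N) 0| ≤ η')
    (q : PathSpace N × ℝ) :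
    |∫ ω', (Ψ₀ (X + displacement s ω') * ((periodicInteraction v L (X + displacement s ω' + displacement (min (q).2.toNNReal (h).toNNReal) (q).1)).toReal - (periodicInteraction v L (X + displacement s ω')).toReal)) ∂wienerPaths N| ≤
      η' + 2 * (M * (((N * N : ℕ) : ℝ) * C)) / δ' * (Real.sqrt 2 * ∑ i, ∑ k, runSup h.toNNReal (q.1 i k)) := by
  set Gb : ℝ := M * (((N * N : ℕ) : ℝ) * C) with hGb
  set R : ℝ := Real.sqrt 2 * ∑ i, ∑ k, runSup h.toNNReal (q.1 i k) with hR
  have hGb0 : 0 ≤ Gb := (abs_nonneg _).trans (abs_smoothedTranslate_le hC hM s X 0)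
  have hR0 : 0 ≤ R := mul_nonneg (Real.sqrt_nonneg _)
    (Finset.sum_nonneg fun i _ => Finset.sum_nonneg fun k _ => runSup_nonneg _ _)
  have hU : ‖displacement (min q.2.toNNReal h.toNNReal) q.1‖ ≤ R :=
    norm_displacement_le_sum_runSup (min_le_right _ _) q.1
  rw [integral_exchInt_eq hv hC hΨm hM s h X q]
  by_cases hRδ : R < δ'
  · exact (hmod _ (hU.trans_lt hRδ)).trans (le_add_of_nonneg_right (by positivity))
  · have hRδ' : δ' ≤ R := not_lt.1 hRδ
    have hb1 := abs_smoothedTranslate_le hC hM s X (displacement (min q.2.toNNReal h.toNNReal) q.1)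
    have hb0 := abs_smoothedTranslate_le hC hM s X 0
    have h1 : |(∫ ω, Ψ₀ (X + displacement s ω) * (periodicInteraction v L (X + displacement s ω + (displacement (min q.2.toNNReal h.toNNReal) q.1))).toReal ∂wienerPaths N) -
        (fun U : Config N => ∫ ω, Ψ₀ (X + displacement s ω) * (periodicInteraction v L (X + displacement s ω + U)).toReal ∂wienerPaths N) 0| ≤ 2 * Gb :=
      (abs_sub _ _).trans (by linarith)
    have h2 : 2 * Gb ≤ 2 * Gb / δ' * R := by
      rw [div_mul_eq_mul_div, le_div_iff₀ hδ']
      exact mul_le_mul_of_nonneg_left hRδ' (by positivity)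
    linarith

/-- **Bound of the smoothed third piece**: under the modulus of continuity of `G` at `0`, for `0 ≤ h`,
`|P_s F₃(X)| ≤ h · (η' + (2G_b/δ') · √2 · 3N · 2√h⁺)`. [folklore] -/
theorem abs_heatOp_thirdPiece_le (hv : Measurable v) (hC : ∀ x, periodizedPotential v L x ≤ C)
    (hΨm : Measurable Ψ₀) (hM : ∀ Y, |Ψ₀ Y| ≤ M) (s : ℝ≥0) {h : ℝ} (hh : 0 ≤ h) (X : Config N)
    {η' δ' : ℝ} (hη' : 0 ≤ η') (hδ' : 0 < δ')
    (hmod : ∀ U : Config N, ‖U‖ < δ' →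
      |(∫ ω, Ψ₀ (X + displacement s ω) * (periodicInteraction v L (X + displacement s ω + U)).toReal ∂wienerPaths N) - (fun U : Config N => ∫ ω, Ψ₀ (X + displacement s ω) * (periodicInteraction v L (X + displacement s ω + U)).toReal ∂wienerPaths N) 0| ≤ η') :
    |heatOp s ((fun Y : Config N => ((∫ ω, (periodicPathAction v L h Y ω).toReal ∂wienerPaths N) - h * (periodicInteraction v L Y).toReal) * Ψ₀ Y)) X| ≤
      h * (η' + 2 * (M * (((N * N : ℕ) : ℝ) * C)) / δ' *
        (Real.sqrt 2 * ((3 * N : ℕ) * (2 * Real.sqrt h.toNNReal)))) := by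
  haveI : Fact (volume (Ioc (0 : ℝ) h) < ∞) := ⟨measure_Ioc_lt_top⟩
  set Gb : ℝ := M * (((N * N : ℕ) : ℝ) * C) with hGb
  have hGb0 : 0 ≤ Gb := (abs_nonneg _).trans (abs_smoothedTranslate_le hC hM s X 0)
  set g : PathSpace N → ℝ := fun ω =>
    η' + 2 * Gb / δ' * (Real.sqrt 2 * ∑ i, ∑ k, runSup h.toNNReal (ω i k)) with hg
  have hgi : Integrable g (wienerPaths N) :=
    (integrable_const η').add (((integrable_sum_runSup h.toNNReal).const_mul (Real.sqrt 2)).const_mul _)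
  rw [heatOp_thirdPiece_eq hv hC hΨm hM s hh X, ← Real.norm_eq_abs]
  refine (norm_integral_le_integral_norm _).trans ?_
  calc ∫ q, ‖∫ ω', (Ψ₀ (X + displacement s ω') * ((periodicInteraction v L (X + displacement s ω' + displacement (min (q).2.toNNReal (h).toNNReal) (q).1)).toReal - (periodicInteraction v L (X + displacement s ω')).toReal)) ∂wienerPaths N‖ ∂(wienerPaths N).prod (volume.restrict (Ioc (0 : ℝ) h))
      ≤ ∫ q, g q.1 ∂(wienerPaths N).prod (volume.restrict (Ioc (0 : ℝ) h)) := by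
        refine integral_mono_of_nonneg (Eventually.of_forall fun _ => norm_nonneg _)
          (hgi.comp_fst _) (Eventually.of_forall fun q => ?_)
        simp only [Real.norm_eq_abs]
        exact abs_integral_exchInt_le hv hC hΨm hM s h X hη' hδ' hmod q
    _ = h * ∫ ω, g ω ∂wienerPaths N := by
        rw [integral_fun_fst, measureReal_restrict_apply_univ, Real.volume_real_Ioc_of_le hh, sub_zero,
          smul_eq_mul]
    _ ≤ h * (η' + 2 * Gb / δ' * (Real.sqrt 2 * ((3 * N : ℕ) * (2 * Real.sqrt h.toNNReal)))) := by
        refine mul_le_mul_of_nonneg_left ?_ hh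
        rw [hg, integral_add (integrable_const η')
          (((integrable_sum_runSup h.toNNReal).const_mul (Real.sqrt 2)).const_mul _), integral_const,
          integral_const_mul, integral_const_mul]
        simp only [probReal_univ, one_smul]
        refine add_le_add le_rfl (mul_le_mul_of_nonneg_left
          (mul_le_mul_of_nonneg_left (integral_sum_runSup_le _) (Real.sqrt_nonneg _)) ?_)
        positivity

end Fubini

end SmoothedGenerator

open SmoothedGenerator in
/-- **Registered sub-goal `stub_smoothedGeneratorFubini` of stub S6r-B1** (line `third-law-current-floor`, crux
`HardCoreExtension`): the bound of the smoothed third piece — if `‖U‖ < δ' ⇒ |G(U) − G(0)| ≤ η'` for the smoothed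
translate `G(U) = E[Ψ₀(X + √2b_s) W(X + √2b_s + U)]`, then for `0 ≤ h`,
`|P_s F₃ (X)| ≤ h·(η' + (2MN²C/δ')·√2·3N·2√h⁺)` (= `abs_heatOp_thirdPiece_le`, closed form). [folklore] -/
theorem stub_smoothedGeneratorFubini :
    ∀ {N : ℕ} (L : ℝ) (v : ℝ → ℝ≥0∞) (C : ℝ≥0), Measurable v → (∀ x, periodizedPotential v L x ≤ C) →
      ∀ (Ψ₀ : Config N → ℝ) (M : ℝ), Measurable Ψ₀ → (∀ Y, |Ψ₀ Y| ≤ M) →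
      ∀ (s : ℝ≥0) (h : ℝ), 0 ≤ h → ∀ (X : Config N) (η' δ' : ℝ), 0 ≤ η' → 0 < δ' →
        (∀ U : Config N, ‖U‖ < δ' →
          |(∫ ω, Ψ₀ (X + displacement s ω) * (periodicInteraction v L (X + displacement s ω + U)).toReal
              ∂wienerPaths N) -
            (∫ ω, Ψ₀ (X + displacement s ω) * (periodicInteraction v L (X + displacement s ω + 0)).toReal
              ∂wienerPaths N)| ≤ η') →
        |heatOp s (fun Y : Config N => ((∫ ω, (periodicPathAction v L h Y ω).toReal ∂wienerPaths N) -
            h * (periodicInteraction v L Y).toReal) * Ψ₀ Y) X| ≤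
          h * (η' + 2 * (M * (((N * N : ℕ) : ℝ) * C)) / δ' *
            (Real.sqrt 2 * ((3 * N : ℕ) * (2 * Real.sqrt h.toNNReal)))) :=
  fun _ _ _ hv hC _ _ hΨm hM s _ hh X _ _ hη' hδ' hmod =>
    abs_heatOp_thirdPiece_le hv hC hΨm hM s hh X hη' hδ' hmod

end Summit.AtomisticToContinuum.BoseEinsteinCondensation.Cruxes.HardCoreExtension.ThirdLawCurrentFloor

end
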